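import Summits.NavierStokesRegularity.NavierStokesRegularity.Theorems.AxisymmetricExtremalityAxisymmetricKatoGlobalStubSeregin2020TypeIILemma22SublevelEnergyTools
import Literature.Analysis.FluidPDE.KNSSSwirlTransport
import Summits.NavierStokesRegularity.NavierStokesRegularity.Theorems.AxisymmetricExtremalityAxisymmetricKatoGlobalStubSeregin2020TypeIILemma22RpowProfile
import HarnessLib

/-!
# Seregin 2020, Lemma 2.2 (after Nazarov–Uraltseva 2012): the slice estimate of N–U Lemma 3.2
# with the profiles `((κ - τ)₊)^p`, `p > 2`, from the energy class in its canonical SPLIT form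

Helper toward the stub `stub_seregin2020TypeII` of the crux `AxisymmetricKatoGlobal` (= the named
fact `Literature.Analysis.FluidPDE.Seregin2020_axisymmetricSingularPoint_typeII`, Seregin 2020,
Thm 2.1), reduced in the tree to `hWH′` (= N–U 2012 Lemma 4.2 for the class 𝒱). N–U Lemma 3.2
(registered atom `lemma22_densityPropagation` of stmt-15453) tests the energy inequality with
`(V - k)₋² ζ²`; the cell's energy class admits `C²` profiles only, so we test with
`H_p(τ) = ((κ - τ)₊)^p`, `p > 2` (`SignedPowers`), and recover N–U's constants by letting
`p → 2⁺` in the sibling `…Lemma22DensityAtom`. This file proves the slice estimate for a fixed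
`p ∈ ]2, 3]` against the energy class EXACTLY as registered (slice integral parenthesised, four
separate Bochner integrals):

* `measure_sublevel_slice_le_rpow` — for `0 < ρ < ρ₁ < 2R`, `-R² < a ≤ t < 0`, `0 < κ ≤ k`,
  `0 < γ < 1`, `2 < p ≤ 3`:
  `((1-γ)κ)^p |B(ρ) ∩ {Φ(t,·) < γκ}| ≤ κ^p |B(ρ₁) ∩ {Φ(a,·) < κ}|
     + κ^p (4A²(t-a)|B̄(ρ₁)| + 2A I_U + 4A I_ϱ)`, `A = C_g/(ρ₁-ρ)`.

## References

* A. I. Nazarov, N. N. Uraltseva, St. Petersburg Math. J. 23 (2012) 93–115 = arXiv:1011.1888,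
  §3, Lemma 3.2 and its proof, Remark 9. [NazarovUraltseva2012]
* G. Seregin, Anal. Math. Phys. 10 (2020), Paper 46 = arXiv:2006.04140, Lemma 2.2. [Seregin2020]
-/

-- the problem directory repeats the summit name (D-0017); core's `dupNamespace` linter fires
set_option linter.dupNamespace false

noncomputable section

open MeasureTheory Set Function Filter Topology Metric Module
open scoped NNReal ENNReal

namespace Summit.NavierStokesRegularity.NavierStokesRegularity.Theorems.AxisymmetricKatoGlobal.EulerScaling

open Literature.Analysis.FluidPDE Literature.Analysis.FluidPDE.LeiZhang2011

set_option maxHeartbeats 400000 in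
/-- **Nazarov–Uraltseva 2012, the slice estimate of Lemma 3.2 (propagation of density), in
Seregin's class 𝒱, profile `((κ-τ)₊)^p`, split energy class.** See the module docstring for the statement; `hEC`
is `EnergyClass Φ U k R` of the De Giorgi skeleton written out.
[cite: NazarovUraltseva2012, Lemma 3.2 (proof), Remark 9; Seregin2020, Lemma 2.2] -/
theorem measure_sublevel_slice_le_rpow
    (Φ : ℝ → EuclideanSpace ℝ (Fin 3) → ℝ)
    (U : ℝ → EuclideanSpace ℝ (Fin 3) → EuclideanSpace ℝ (Fin 3)) (k R : ℝ)
    (hΦm : Measurable (uncurry Φ)) (hΦ0 : ∀ t x, 0 ≤ Φ t x)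
    (hU : AEStronglyMeasurable (uncurry U)
      (volume.restrict (Ioo (-R ^ 2) 0 ×ˢ ball (0 : EuclideanSpace ℝ (Fin 3)) (2 * R))))
    (hEC : ∀ (H : ℝ → ℝ), ContDiff ℝ 2 H → (∀ v, deriv H v ≤ 0) → (∀ v, 0 ≤ H v) →
      (∀ v, 0 ≤ deriv (deriv H) v) → (∀ v, deriv H v ^ 2 ≤ 2 * H v * deriv (deriv H) v) →
      (∀ v, k ≤ v → H v = 0) →
      ∀ (Θ : EuclideanSpace ℝ (Fin 3) → ℝ), ContDiff ℝ 1 Θ → HasCompactSupport Θ →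
        tsupport Θ ⊆ ball (0 : EuclideanSpace ℝ (Fin 3)) (2 * R) →
      ∀ (η : ℝ → ℝ), ContDiff ℝ 1 η → (∀ s, 0 ≤ η s) →
      ∀ (t₁ t₂ : ℝ), -R ^ 2 < t₁ → t₁ ≤ t₂ → t₂ < 0 →
        ENNReal.ofReal (η t₂ * ∫ x, H (Φ t₂ x) * Θ x ^ 2) +
          ∫⁻ z in Icc t₁ t₂ ×ˢ (univ : Set (EuclideanSpace ℝ (Fin 3))), ENNReal.ofReal
            (1 / 2 * η z.1 * (deriv (deriv H) (Φ z.1 z.2) * ‖gradient (Φ z.1) z.2‖ ^ 2 *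
              Θ z.2 ^ 2))
        ≤ ENNReal.ofReal (η t₁ * (∫ x, H (Φ t₁ x) * Θ x ^ 2) +
            (4 * ∫ z in Icc t₁ t₂ ×ˢ (univ : Set (EuclideanSpace ℝ (Fin 3))),
              η z.1 * (H (Φ z.1 z.2) * ‖gradient Θ z.2‖ ^ 2)) +
            (∫ z in Icc t₁ t₂ ×ˢ (univ : Set (EuclideanSpace ℝ (Fin 3))),
              η z.1 * (H (Φ z.1 z.2) * inner ℝ (U z.1 z.2) (gradient (fun y => Θ y ^ 2) z.2))) +
            (∫ z in Icc t₁ t₂ ×ˢ (univ : Set (EuclideanSpace ℝ (Fin 3))),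
              η z.1 * (2 / cylRadius z.2 *
                (H (Φ z.1 z.2) * fderiv ℝ (fun y => Θ y ^ 2) z.2 (eR z.2)))) +
            (∫ z in Icc t₁ t₂ ×ˢ (univ : Set (EuclideanSpace ℝ (Fin 3))),
              |deriv η z.1| * (H (Φ z.1 z.2) * Θ z.2 ^ 2))))
    {ρ ρ₁ a t₀ κ γ : ℝ} (hρ : 0 < ρ) (hρ₁ : ρ < ρ₁) (hρ₁R : ρ₁ < 2 * R) (ha : -R ^ 2 < a)
    (hat : a ≤ t₀) (ht₀ : t₀ < 0) (hκ : 0 < κ) (hκk : κ ≤ k) (hγ : 0 < γ) (hγ1 : γ < 1)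
    {p : ℝ} (hp : 2 < p)
    {Cg : ℝ} (hCg0 : 0 ≤ Cg)
    (hCg : ∀ x, ‖fderiv ℝ (radialCutoff ρ ρ₁ : EuclideanSpace ℝ (Fin 3) → ℝ) x‖ ≤ Cg / (ρ₁ - ρ))
    {IU Iϱ : ℝ≥0∞} (hIUfin : IU ≠ ∞) (hIϱfin : Iϱ ≠ ∞)
    (hIU : ∫⁻ z in Icc a t₀ ×ˢ closedBall (0 : EuclideanSpace ℝ (Fin 3)) ρ₁, ‖U z.1 z.2‖ₑ ≤ IU)
    (hIϱ : ∫⁻ z in Icc a t₀ ×ˢ closedBall (0 : EuclideanSpace ℝ (Fin 3)) ρ₁,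
      ENNReal.ofReal (cylRadius z.2)⁻¹ ≤ Iϱ) :
    ((1 - γ) * κ) ^ p *
        (volume (ball (0 : EuclideanSpace ℝ (Fin 3)) ρ ∩ {x | Φ t₀ x < γ * κ})).toReal ≤
      κ ^ p * (volume (ball (0 : EuclideanSpace ℝ (Fin 3)) ρ₁ ∩ {x | Φ a x < κ})).toReal +
        κ ^ p * (4 * (Cg / (ρ₁ - ρ)) ^ 2 * ((t₀ - a) *
            (volume (closedBall (0 : EuclideanSpace ℝ (Fin 3)) ρ₁)).toReal) +
          2 * (Cg / (ρ₁ - ρ)) * IU.toReal + 4 * (Cg / (ρ₁ - ρ)) * Iϱ.toReal) := by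
  set K : Set (EuclideanSpace ℝ (Fin 3)) := closedBall (0 : EuclideanSpace ℝ (Fin 3)) ρ₁ with hK
  set VK : ℝ := (volume K).toReal with hVK
  set A : ℝ := Cg / (ρ₁ - ρ) with hA
  have hρ₁pos : 0 < ρ₁ := hρ.trans hρ₁
  have hA0 : 0 ≤ A := by rw [hA]; exact div_nonneg hCg0 (by linarith)
  have hKm : MeasurableSet K := measurableSet_closedBall
  have hKfin : volume K < ∞ := measure_closedBall_lt_top
  have hta : 0 ≤ t₀ - a := by linarith
  have hκp : 0 < κ ^ p := Real.rpow_pos_of_pos hκ p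
  set H : ℝ → ℝ := fun τ => max (κ - τ) 0 ^ p with hH
  obtain ⟨hH2, hH', hH0, hH'', hHsq, hHκ, hHmax, hHlow⟩ := rpowProfile_props hp hκ
  have hHk : ∀ v, k ≤ v → H v = 0 := fun v hv => hHκ v (hκk.trans hv)
  obtain ⟨hΘ1, hΘc, hΘK, hΘ01, hΘone, hΘzero⟩ := radialCutoff_energy_props hρ hρ₁
  set Θ : EuclideanSpace ℝ (Fin 3) → ℝ := radialCutoff ρ ρ₁ with hΘ
  have hΘsupp : tsupport Θ ⊆ ball (0 : EuclideanSpace ℝ (Fin 3)) (2 * R) :=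
    hΘK.trans (closedBall_subset_ball hρ₁R)
  have hΘA : ∀ x, ‖fderiv ℝ Θ x‖ ≤ A := hCg
  set η : ℝ → ℝ := fun _ => 1 with hη
  have hη1 : ContDiff ℝ 1 η := contDiff_const
  have hη0 : ∀ s, 0 ≤ η s := fun _ => zero_le_one
  set T₁ : ℝ × EuclideanSpace ℝ (Fin 3) → ℝ := fun z =>
    η z.1 * (H (Φ z.1 z.2) * ‖gradient Θ z.2‖ ^ 2) with hT₁
  set T₂ : ℝ × EuclideanSpace ℝ (Fin 3) → ℝ := fun z =>
    η z.1 * (H (Φ z.1 z.2) * inner ℝ (U z.1 z.2) (gradient (fun y => Θ y ^ 2) z.2)) with hT₂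
  set T₃ : ℝ × EuclideanSpace ℝ (Fin 3) → ℝ := fun z => η z.1 *
    (2 / cylRadius z.2 * (H (Φ z.1 z.2) * fderiv ℝ (fun y => Θ y ^ 2) z.2 (eR z.2))) with hT₃
  set T₄ : ℝ × EuclideanSpace ℝ (Fin 3) → ℝ := fun z =>
    |deriv η z.1| * (H (Φ z.1 z.2) * Θ z.2 ^ 2) with hT₄
  set d₁ : ℝ := κ ^ p * A ^ 2 with hd₁
  set c₂ : ℝ := κ ^ p * (2 * A) with hc₂
  set c₃ : ℝ := κ ^ p * (4 * A) with hc₃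
  have hd₁0 : 0 ≤ d₁ := by positivity
  have hc₂0 : 0 ≤ c₂ := by positivity
  have hc₃0 : 0 ≤ c₃ := by positivity
  have hηz : ∀ s, η s = 1 := fun _ => rfl
  have hdη : ∀ s, deriv η s = 0 := fun s => by rw [hη]; exact deriv_const s 1
  set KK : Set (ℝ × EuclideanSpace ℝ (Fin 3)) := (univ : Set ℝ) ×ˢ K with hKK
  have hKKm : MeasurableSet KK := MeasurableSet.univ.prod hKm
  have hmemKK : ∀ z : ℝ × EuclideanSpace ℝ (Fin 3), z ∈ KK ↔ z.2 ∈ K := fun z => by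
    simp [hKK]
  have hT₄0 : ∀ z, T₄ z = 0 := fun z => by
    show |deriv η z.1| * (H (Φ z.1 z.2) * Θ z.2 ^ 2) = 0
    rw [hdη, abs_zero, zero_mul]
  have hHle : ∀ z : ℝ × EuclideanSpace ℝ (Fin 3), H (Φ z.1 z.2) ≤ κ ^ p := fun z => hHmax _ (hΦ0 _ _)
  have hHnn : ∀ z : ℝ × EuclideanSpace ℝ (Fin 3), 0 ≤ H (Φ z.1 z.2) := fun z => hH0 _
  have hgΘ : ∀ x, ‖gradient Θ x‖ ≤ A := fun x => by rw [norm_gradient_eq_norm_fderiv]; exact hΘA _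
  have hgΘ2 : ∀ x, ‖gradient (fun y => Θ y ^ 2) x‖ ≤ 2 * A := fun x => by
    refine (norm_gradient_sq_le hΘ1 x).trans ?_
    have h1 : |Θ x| ≤ 1 := by rw [abs_of_nonneg (hΘ01 x).1]; exact (hΘ01 x).2
    calc 2 * |Θ x| * ‖fderiv ℝ Θ x‖ ≤ 2 * 1 * A := by gcongr; exact hΘA _
      _ = 2 * A := by ring
  have hdΘ2 : ∀ x, |fderiv ℝ (fun y => Θ y ^ 2) x (eR x)| ≤ 2 * A := fun x => by
    rw [fderiv_sq_apply hΘ1, abs_mul, abs_mul, abs_two, abs_of_nonneg (hΘ01 x).1]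
    have h1 : |fderiv ℝ Θ x (eR x)| ≤ A := by
      have h := ContinuousLinearMap.le_opNorm (fderiv ℝ Θ x) (eR x)
      rw [Real.norm_eq_abs] at h
      calc |fderiv ℝ Θ x (eR x)| ≤ ‖fderiv ℝ Θ x‖ * ‖eR x‖ := h
        _ ≤ A * 1 := by gcongr; exacts [hΘA _, norm_eR_le_one _]
        _ = A := mul_one A
    calc 2 * Θ x * |fderiv ℝ Θ x (eR x)| ≤ 2 * 1 * A := by gcongr; exact (hΘ01 x).2
      _ = 2 * A := by ring
  have hB₁ : ∀ z, ‖T₁ z‖ₑ ≤ KK.indicator (fun _ => ENNReal.ofReal d₁) z := by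
    intro z
    by_cases hz : z.2 ∈ K
    · rw [indicator_of_mem ((hmemKK z).2 hz)]
      have hreal : |T₁ z| ≤ d₁ := by
        show |η z.1 * (H (Φ z.1 z.2) * ‖gradient Θ z.2‖ ^ 2)| ≤ d₁
        rw [hηz z.1, one_mul, abs_of_nonneg (mul_nonneg (hHnn z) (sq_nonneg _)), hd₁]
        have : ‖gradient Θ z.2‖ ^ 2 ≤ A ^ 2 := pow_le_pow_left₀ (norm_nonneg _) (hgΘ _) 2
        nlinarith [mul_le_mul (hHle z) this (sq_nonneg _) (by positivity)]
      rw [Real.enorm_eq_ofReal_abs]; exact ENNReal.ofReal_le_ofReal hreal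
    · obtain ⟨-, hdΘ0, -⟩ := hΘzero z.2 hz
      have hg1 : gradient Θ z.2 = 0 := by unfold gradient; rw [hdΘ0]; simp
      have : T₁ z = 0 := by
        show η z.1 * (H (Φ z.1 z.2) * ‖gradient Θ z.2‖ ^ 2) = 0
        rw [hg1]; simp
      rw [this, enorm_zero]; exact zero_le
  have hB₂ : ∀ z, ‖T₂ z‖ₑ ≤ KK.indicator (fun z => ENNReal.ofReal c₂ * ‖U z.1 z.2‖ₑ) z := by
    intro z
    by_cases hz : z.2 ∈ K
    · rw [indicator_of_mem ((hmemKK z).2 hz)]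
      have hreal : |T₂ z| ≤ c₂ * ‖U z.1 z.2‖ := by
        show |η z.1 * (H (Φ z.1 z.2) * inner ℝ (U z.1 z.2) (gradient (fun y => Θ y ^ 2) z.2))| ≤ _
        rw [hηz z.1, one_mul, abs_mul, abs_of_nonneg (hHnn z), hc₂]
        have hin : |inner ℝ (U z.1 z.2) (gradient (fun y => Θ y ^ 2) z.2)| ≤ ‖U z.1 z.2‖ * (2 * A) :=
          (abs_real_inner_le_norm _ _).trans (mul_le_mul_of_nonneg_left (hgΘ2 _) (norm_nonneg _))
        calc H (Φ z.1 z.2) * |inner ℝ (U z.1 z.2) (gradient (fun y => Θ y ^ 2) z.2)|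
            ≤ κ ^ p * (‖U z.1 z.2‖ * (2 * A)) :=
              mul_le_mul (hHle z) hin (abs_nonneg _) (by positivity)
          _ = κ ^ p * (2 * A) * ‖U z.1 z.2‖ := by ring
      calc ‖T₂ z‖ₑ = ENNReal.ofReal |T₂ z| := by rw [← Real.enorm_eq_ofReal_abs]
        _ ≤ ENNReal.ofReal (c₂ * ‖U z.1 z.2‖) := ENNReal.ofReal_le_ofReal hreal
        _ = ENNReal.ofReal c₂ * ‖U z.1 z.2‖ₑ := by rw [ENNReal.ofReal_mul hc₂0, ofReal_norm]
    · obtain ⟨-, -, hg2⟩ := hΘzero z.2 hz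
      have : T₂ z = 0 := by
        show η z.1 * (H (Φ z.1 z.2) * inner ℝ (U z.1 z.2) (gradient (fun y => Θ y ^ 2) z.2)) = 0
        rw [hg2]; simp
      rw [this, enorm_zero]; exact zero_le
  have hB₃ : ∀ z, ‖T₃ z‖ₑ ≤
      KK.indicator (fun z => ENNReal.ofReal c₃ * ENNReal.ofReal (cylRadius z.2)⁻¹) z := by
    intro z
    by_cases hz : z.2 ∈ K
    · rw [indicator_of_mem ((hmemKK z).2 hz)]
      have hρinv : 0 ≤ (cylRadius z.2)⁻¹ := inv_nonneg.2 (cylRadius_nonneg _)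
      have h2ρ : |2 / cylRadius z.2| = 2 * (cylRadius z.2)⁻¹ := by
        rw [div_eq_mul_inv, abs_mul, abs_two, abs_of_nonneg hρinv]
      have hreal : |T₃ z| ≤ c₃ * (cylRadius z.2)⁻¹ := by
        show |η z.1 * (2 / cylRadius z.2 *
          (H (Φ z.1 z.2) * fderiv ℝ (fun y => Θ y ^ 2) z.2 (eR z.2)))| ≤ _
        rw [hηz z.1, one_mul, abs_mul, h2ρ, abs_mul, abs_of_nonneg (hHnn z), hc₃]
        have : H (Φ z.1 z.2) * |fderiv ℝ (fun y => Θ y ^ 2) z.2 (eR z.2)| ≤ κ ^ p * (2 * A) :=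
          mul_le_mul (hHle z) (hdΘ2 _) (abs_nonneg _) (by positivity)
        calc 2 * (cylRadius z.2)⁻¹ * (H (Φ z.1 z.2) * |fderiv ℝ (fun y => Θ y ^ 2) z.2 (eR z.2)|)
            ≤ 2 * (cylRadius z.2)⁻¹ * (κ ^ p * (2 * A)) :=
              mul_le_mul_of_nonneg_left this (by positivity)
          _ = κ ^ p * (4 * A) * (cylRadius z.2)⁻¹ := by ring
      calc ‖T₃ z‖ₑ = ENNReal.ofReal |T₃ z| := by rw [← Real.enorm_eq_ofReal_abs]
        _ ≤ ENNReal.ofReal (c₃ * (cylRadius z.2)⁻¹) := ENNReal.ofReal_le_ofReal hreal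
        _ = ENNReal.ofReal c₃ * ENNReal.ofReal (cylRadius z.2)⁻¹ := by rw [ENNReal.ofReal_mul hc₃0]
    · obtain ⟨hΘ0', -, -⟩ := hΘzero z.2 hz
      have : T₃ z = 0 := by
        show η z.1 * (2 / cylRadius z.2 *
          (H (Φ z.1 z.2) * fderiv ℝ (fun y => Θ y ^ 2) z.2 (eR z.2))) = 0
        rw [fderiv_sq_apply hΘ1, hΘ0']; simp
      rw [this, enorm_zero]; exact zero_le
  have hIcc_sub : ∀ t₂, t₂ ≤ t₀ → Icc a t₂ ×ˢ K ⊆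
      Ioo (-R ^ 2) 0 ×ˢ ball (0 : EuclideanSpace ℝ (Fin 3)) (2 * R) := by
    intro t₂ ht₂
    refine prod_mono (fun s hs => ⟨ha.trans_le hs.1, hs.2.trans_lt (ht₂.trans_lt ht₀)⟩)
      (closedBall_subset_ball hρ₁R)
  have hUe : ∀ t₂, t₂ ≤ t₀ → AEMeasurable (fun z : ℝ × EuclideanSpace ℝ (Fin 3) => ‖U z.1 z.2‖ₑ)
      (volume.restrict (Icc a t₂ ×ˢ K)) := by
    intro t₂ ht₂
    exact (hU.mono_measure (Measure.restrict_mono (hIcc_sub t₂ ht₂) le_rfl)).enorm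
  have hρm : Measurable fun z : ℝ × EuclideanSpace ℝ (Fin 3) =>
      ENNReal.ofReal (cylRadius z.2)⁻¹ :=
    ENNReal.measurable_ofReal.comp ((continuous_cylRadius.measurable.comp measurable_snd).inv)
  have hrestr : ∀ t₂, (volume.restrict (Icc a t₂ ×ˢ (univ : Set (EuclideanSpace ℝ (Fin 3))))).restrict KK
      = volume.restrict (Icc a t₂ ×ˢ K) := fun t₂ => by
    rw [Measure.restrict_restrict hKKm, hKK, prod_inter_prod, univ_inter, inter_univ]
  have hvolK : ∀ t₂, t₂ ≤ t₀ → volume (Icc a t₂ ×ˢ K) ≤ ENNReal.ofReal (t₀ - a) * volume K := by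
    intro t₂ ht₂
    calc volume (Icc a t₂ ×ˢ K) ≤ volume (Icc a t₀ ×ˢ K) :=
          measure_mono (prod_mono (Icc_subset_Icc le_rfl ht₂) le_rfl)
      _ = ENNReal.ofReal (t₀ - a) * volume K := by
          rw [Measure.volume_eq_prod, Measure.prod_prod, Real.volume_Icc]
  have hI₁ : ∀ t₂, t₂ ≤ t₀ →
      ∫⁻ z in Icc a t₂ ×ˢ (univ : Set (EuclideanSpace ℝ (Fin 3))), ‖T₁ z‖ₑ ≤
        ENNReal.ofReal d₁ * (ENNReal.ofReal (t₀ - a) * volume K) := by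
    intro t₂ ht₂
    calc ∫⁻ z in Icc a t₂ ×ˢ (univ : Set (EuclideanSpace ℝ (Fin 3))), ‖T₁ z‖ₑ
        ≤ ∫⁻ z in Icc a t₂ ×ˢ (univ : Set (EuclideanSpace ℝ (Fin 3))),
            KK.indicator (fun _ => ENNReal.ofReal d₁) z := lintegral_mono fun z => hB₁ z
      _ = ENNReal.ofReal d₁ * volume (Icc a t₂ ×ˢ K) := by
          rw [lintegral_indicator_const hKKm, Measure.restrict_apply hKKm, hKK, prod_inter_prod,
            univ_inter, inter_univ]
      _ ≤ _ := mul_le_mul' le_rfl (hvolK t₂ ht₂)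
  have hI₂ : ∀ t₂, t₂ ≤ t₀ →
      ∫⁻ z in Icc a t₂ ×ˢ (univ : Set (EuclideanSpace ℝ (Fin 3))), ‖T₂ z‖ₑ ≤
        ENNReal.ofReal c₂ * IU := by
    intro t₂ ht₂
    have hsubt : Icc a t₂ ×ˢ K ⊆ Icc a t₀ ×ˢ K := prod_mono (Icc_subset_Icc le_rfl ht₂) le_rfl
    calc ∫⁻ z in Icc a t₂ ×ˢ (univ : Set (EuclideanSpace ℝ (Fin 3))), ‖T₂ z‖ₑ
        ≤ ∫⁻ z in Icc a t₂ ×ˢ (univ : Set (EuclideanSpace ℝ (Fin 3))),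
            KK.indicator (fun z => ENNReal.ofReal c₂ * ‖U z.1 z.2‖ₑ) z := lintegral_mono fun z => hB₂ z
      _ = ∫⁻ z in Icc a t₂ ×ˢ K, ENNReal.ofReal c₂ * ‖U z.1 z.2‖ₑ := by
          rw [lintegral_indicator hKKm, hrestr t₂]
      _ = ENNReal.ofReal c₂ * ∫⁻ z in Icc a t₂ ×ˢ K, ‖U z.1 z.2‖ₑ :=
          lintegral_const_mul'' _ (hUe t₂ ht₂)
      _ ≤ ENNReal.ofReal c₂ * IU := mul_le_mul' le_rfl ((lintegral_mono_set hsubt).trans hIU)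
  have hI₃ : ∀ t₂, t₂ ≤ t₀ →
      ∫⁻ z in Icc a t₂ ×ˢ (univ : Set (EuclideanSpace ℝ (Fin 3))), ‖T₃ z‖ₑ ≤
        ENNReal.ofReal c₃ * Iϱ := by
    intro t₂ ht₂
    have hsubt : Icc a t₂ ×ˢ K ⊆ Icc a t₀ ×ˢ K := prod_mono (Icc_subset_Icc le_rfl ht₂) le_rfl
    calc ∫⁻ z in Icc a t₂ ×ˢ (univ : Set (EuclideanSpace ℝ (Fin 3))), ‖T₃ z‖ₑ
        ≤ ∫⁻ z in Icc a t₂ ×ˢ (univ : Set (EuclideanSpace ℝ (Fin 3))),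
            KK.indicator (fun z => ENNReal.ofReal c₃ * ENNReal.ofReal (cylRadius z.2)⁻¹) z :=
          lintegral_mono fun z => hB₃ z
      _ = ∫⁻ z in Icc a t₂ ×ˢ K, ENNReal.ofReal c₃ * ENNReal.ofReal (cylRadius z.2)⁻¹ := by
          rw [lintegral_indicator hKKm, hrestr t₂]
      _ = ENNReal.ofReal c₃ * ∫⁻ z in Icc a t₂ ×ˢ K, ENNReal.ofReal (cylRadius z.2)⁻¹ :=
          lintegral_const_mul _ hρm
      _ ≤ ENNReal.ofReal c₃ * Iϱ := mul_le_mul' le_rfl ((lintegral_mono_set hsubt).trans hIϱ)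
  -- ### the energy inequality between `a` and `t₀`
  have hreal_of_lintegral : ∀ (T : ℝ × EuclideanSpace ℝ (Fin 3) → ℝ) (B : ℝ≥0∞),
      B ≠ ∞ → ∫⁻ z in Icc a t₀ ×ˢ (univ : Set (EuclideanSpace ℝ (Fin 3))), ‖T z‖ₑ ≤ B →
      (∫ z in Icc a t₀ ×ˢ (univ : Set (EuclideanSpace ℝ (Fin 3))), T z) ≤ B.toReal := by
    intro T B hB hle
    have h1 := norm_integral_le_lintegral_norm
      (μ := volume.restrict (Icc a t₀ ×ˢ (univ : Set (EuclideanSpace ℝ (Fin 3))))) T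
    have h2 : ∫⁻ z in Icc a t₀ ×ˢ (univ : Set (EuclideanSpace ℝ (Fin 3))), ENNReal.ofReal ‖T z‖ ≤ B := by
      refine (lintegral_mono fun z => ?_).trans hle
      rw [ofReal_norm]
    exact (Real.le_norm_self _).trans (h1.trans (ENNReal.toReal_mono hB h2))
  have h' := hEC H hH2 hH' hH0 hH'' hHsq hHk Θ hΘ1 hΘc hΘsupp η hη1 hη0 a t₀ ha hat ht₀
  have h : ENNReal.ofReal (η t₀ * ∫ x, H (Φ t₀ x) * Θ x ^ 2) +
      ∫⁻ z in Icc a t₀ ×ˢ (univ : Set (EuclideanSpace ℝ (Fin 3))), ENNReal.ofReal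
        (1 / 2 * η z.1 * (deriv (deriv H) (Φ z.1 z.2) * ‖gradient (Φ z.1) z.2‖ ^ 2 *
          Θ z.2 ^ 2)) ≤
      ENNReal.ofReal (η a * (∫ x, H (Φ a x) * Θ x ^ 2) +
        (4 * ∫ z in Icc a t₀ ×ˢ (univ : Set (EuclideanSpace ℝ (Fin 3))), T₁ z) +
        (∫ z in Icc a t₀ ×ˢ (univ : Set (EuclideanSpace ℝ (Fin 3))), T₂ z) +
        (∫ z in Icc a t₀ ×ˢ (univ : Set (EuclideanSpace ℝ (Fin 3))), T₃ z) +
        (∫ z in Icc a t₀ ×ˢ (univ : Set (EuclideanSpace ℝ (Fin 3))), T₄ z)) := by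
    simpa only [hT₁, hT₂, hT₃, hT₄] using h'
  have hX : (4 * ∫ z in Icc a t₀ ×ˢ (univ : Set (EuclideanSpace ℝ (Fin 3))), T₁ z) +
      (∫ z in Icc a t₀ ×ˢ (univ : Set (EuclideanSpace ℝ (Fin 3))), T₂ z) +
      (∫ z in Icc a t₀ ×ˢ (univ : Set (EuclideanSpace ℝ (Fin 3))), T₃ z) +
      (∫ z in Icc a t₀ ×ˢ (univ : Set (EuclideanSpace ℝ (Fin 3))), T₄ z) ≤
      4 * d₁ * ((t₀ - a) * VK) + c₂ * IU.toReal + c₃ * Iϱ.toReal := by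
    have e1 := hreal_of_lintegral T₁ _
      (ENNReal.mul_ne_top ENNReal.ofReal_ne_top (ENNReal.mul_ne_top ENNReal.ofReal_ne_top hKfin.ne))
      (hI₁ t₀ le_rfl)
    have e2 := hreal_of_lintegral T₂ _ (ENNReal.mul_ne_top ENNReal.ofReal_ne_top hIUfin) (hI₂ t₀ le_rfl)
    have e3 := hreal_of_lintegral T₃ _ (ENNReal.mul_ne_top ENNReal.ofReal_ne_top hIϱfin) (hI₃ t₀ le_rfl)
    rw [ENNReal.toReal_mul, ENNReal.toReal_mul, ENNReal.toReal_ofReal hd₁0,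
      ENNReal.toReal_ofReal hta, ← hVK] at e1
    rw [ENNReal.toReal_mul, ENNReal.toReal_ofReal hc₂0] at e2
    rw [ENNReal.toReal_mul, ENNReal.toReal_ofReal hc₃0] at e3
    have e4 : (∫ z in Icc a t₀ ×ˢ (univ : Set (EuclideanSpace ℝ (Fin 3))), T₄ z) = 0 := by
      simp only [hT₄0, integral_zero]
    linarith [e1, e2, e3, e4]
  -- upper bound of the initial term by the sublevel measure at time `a`
  set L₀ : Set (EuclideanSpace ℝ (Fin 3)) :=
    ball (0 : EuclideanSpace ℝ (Fin 3)) ρ₁ ∩ {x | Φ a x < κ} with hL₀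
  have hL₀m : MeasurableSet L₀ :=
    measurableSet_ball.inter (measurableSet_lt (hΦm.comp (measurable_const.prodMk measurable_id))
      measurable_const)
  have hL₀fin : volume L₀ ≠ ∞ := (measure_mono inter_subset_left).trans_lt measure_ball_lt_top |>.ne
  have hMa : ∫ x, H (Φ a x) * Θ x ^ 2 ≤ κ ^ p * (volume L₀).toReal := by
    refine integral_le_of_le_indicator_const hL₀m hL₀fin (by positivity) (fun x _ => ?_)
      (fun x hx => ?_)
    · rw [abs_of_nonneg (mul_nonneg (hH0 _) (sq_nonneg _))]
      have hΘsq : Θ x ^ 2 ≤ 1 := by have := hΘ01 x; nlinarith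
      calc H (Φ a x) * Θ x ^ 2 ≤ κ ^ p * 1 :=
          mul_le_mul (hHmax _ (hΦ0 _ _)) hΘsq (sq_nonneg _) hκp.le
        _ = κ ^ p := mul_one _
    · -- off `L₀`: either `‖x‖ ≥ ρ₁` (then `Θ x = 0`) or `Φ a x ≥ κ` (then `H = 0`)
      by_cases hxb : x ∈ ball (0 : EuclideanSpace ℝ (Fin 3)) ρ₁
      · have hΦx : κ ≤ Φ a x := by
          by_contra hlt
          exact hx ⟨hxb, not_le.1 hlt⟩
        have h0 : H (Φ a x) = 0 := hHκ _ hΦx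
        rw [h0, zero_mul]
      · have : ρ₁ ≤ ‖x‖ := by rwa [mem_ball_zero_iff, not_lt] at hxb
        rw [show Θ x = 0 from radialCutoff_eq_zero hρ.le hρ₁ this]; simp
  -- lower bound of the final term by the sublevel measure at time `t₀`
  set L₁ : Set (EuclideanSpace ℝ (Fin 3)) :=
    ball (0 : EuclideanSpace ℝ (Fin 3)) ρ ∩ {x | Φ t₀ x < γ * κ} with hL₁
  have hL₁m : MeasurableSet L₁ :=
    measurableSet_ball.inter (measurableSet_lt (hΦm.comp (measurable_const.prodMk measurable_id))
      measurable_const)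
  have hL₁fin : volume L₁ ≠ ∞ := (measure_mono inter_subset_left).trans_lt measure_ball_lt_top |>.ne
  have hMt : ((1 - γ) * κ) ^ p * (volume L₁).toReal ≤ ∫ x, H (Φ t₀ x) * Θ x ^ 2 := by
    -- `f = H(Φ(t₀,·)) Θ²` is integrable (bounded, measurable, supported in `K`)
    have hfm : AEStronglyMeasurable (fun x => H (Φ t₀ x) * Θ x ^ 2) volume := by
      have h1 : Measurable fun x => Φ t₀ x := hΦm.comp (measurable_const.prodMk measurable_id)
      exact ((hH2.continuous.measurable.comp h1).mul
        ((hΘ1.continuous.pow 2).measurable)).aestronglyMeasurable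
    have hfi : Integrable (fun x => H (Φ t₀ x) * Θ x ^ 2) volume := by
      refine ⟨hfm, ?_⟩
      have hb : ∫⁻ x, ‖H (Φ t₀ x) * Θ x ^ 2‖ₑ ≤ ∫⁻ x, K.indicator (fun _ => ENNReal.ofReal (κ ^ p)) x := by
        refine lintegral_mono fun x => ?_
        by_cases hx : x ∈ K
        · rw [indicator_of_mem hx, Real.enorm_eq_ofReal (mul_nonneg (hH0 _) (sq_nonneg _))]
          refine ENNReal.ofReal_le_ofReal ?_
          have hΘsq : Θ x ^ 2 ≤ 1 := by have := hΘ01 x; nlinarith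
          calc H (Φ t₀ x) * Θ x ^ 2 ≤ κ ^ p * 1 :=
              mul_le_mul (hHmax _ (hΦ0 _ _)) hΘsq (sq_nonneg _) hκp.le
            _ = κ ^ p := mul_one _
        · rw [indicator_of_notMem hx, (hΘzero x hx).1]; simp
      rw [lintegral_indicator_const hKm] at hb
      exact lt_of_le_of_lt hb (ENNReal.mul_lt_top ENNReal.ofReal_lt_top hKfin)
    have hgi : Integrable (L₁.indicator fun _ => ((1 - γ) * κ) ^ p) volume :=
      (integrable_indicator_iff hL₁m).2 (integrableOn_const hL₁fin)
    have hle : ∀ x, L₁.indicator (fun _ => ((1 - γ) * κ) ^ p) x ≤ H (Φ t₀ x) * Θ x ^ 2 := by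
      intro x
      by_cases hx : x ∈ L₁
      · rw [indicator_of_mem hx, hΘone x hx.1, one_pow, mul_one]
        have h0 : 0 ≤ (1 - γ) * κ := by nlinarith
        have h2 : Φ t₀ x ≤ κ - (1 - γ) * κ := by
          have := hx.2; simp only [mem_setOf_eq] at this; linarith
        exact hHlow _ _ h0 h2
      · rw [indicator_of_notMem hx]; exact mul_nonneg (hH0 _) (sq_nonneg _)
    have := integral_mono hgi hfi hle
    rwa [integral_indicator_const _ hL₁m, smul_eq_mul, mul_comm, Measure.real] at this
  -- ### combine
  have hMt' : ∫ x, H (Φ t₀ x) * Θ x ^ 2 ≤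
      (∫ x, H (Φ a x) * Θ x ^ 2) + (4 * d₁ * ((t₀ - a) * VK) + c₂ * IU.toReal + c₃ * Iϱ.toReal) := by
    have hle := le_trans le_self_add h
    simp only [hηz, one_mul] at hle
    have hMa0 : 0 ≤ ∫ x, H (Φ a x) * Θ x ^ 2 :=
      integral_nonneg fun x => mul_nonneg (hH0 _) (sq_nonneg _)
    rcases (ENNReal.ofReal_le_ofReal_iff'.1 hle) with h1 | h1
    · linarith [hX]
    · have hVK0 : 0 ≤ VK := ENNReal.toReal_nonneg
      have : 0 ≤ 4 * d₁ * ((t₀ - a) * VK) + c₂ * IU.toReal + c₃ * Iϱ.toReal :=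
        add_nonneg (add_nonneg (mul_nonneg (by positivity) (mul_nonneg hta hVK0))
          (mul_nonneg hc₂0 ENNReal.toReal_nonneg)) (mul_nonneg hc₃0 ENNReal.toReal_nonneg)
      linarith
  have hc : 4 * d₁ * ((t₀ - a) * VK) + c₂ * IU.toReal + c₃ * Iϱ.toReal =
      κ ^ p * (4 * A ^ 2 * ((t₀ - a) * VK) + 2 * A * IU.toReal + 4 * A * Iϱ.toReal) := by
    rw [hd₁, hc₂, hc₃]; ring
  linarith [hMt, hMt', hMa, hc]

end Summit.NavierStokesRegularity.NavierStokesRegularity.Theorems.AxisymmetricKatoGlobal.EulerScaling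

end
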